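import Literature.Analysis.FluidPDE.TaoForcedNormalisedPressure
import Literature.Analysis.FluidPDE.NewtonPotentialRepresentation
import Literature.Analysis.FluidPDE.HarmonicProbe
import HarnessLib

/-!
# The forced pressure normalisation: `Δ⁻¹∇·(∇g) = g`, and a counterexample to the BOUNDEDNESS
# of the pressure constant in Tao 2011, Lemma 4.1 (i) with force

Analysis/FluidPDE Literature file, everything PROVED (no facts, no `sorry`).

`TaoForcedNormalisedPressure.lean` vendors Tao's Lemma 4.1 (i) = arXiv Lemma 25 (i) of
[Tao 2011] WITH force as the named fact `tao2011_forced_pressure_normalisation`, rendered verbatim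
from print: for a finite energy (almost) smooth solution `(u,p,u₀,f,T)` — `u, p, f` smooth on the
closed slab `[0,T] × ℝ³`, `‖f‖_{L¹_t L²_x} < ∞`, `sup_t ∫|u(t)|² < ∞` — there is a **bounded**
measurable `C : [0,T] → ℝ` with `p(t) = -Δ⁻¹∂ᵢ∂ⱼ(uᵢuⱼ)(t) + Δ⁻¹∇·f(t) + C(t)` for a.e. `t`
(arXiv:1108.1165, p. 14: "for some bounded measurable function `C`").

This file shows that the conjunct "`C` bounded" is FALSE on that hypothesis class
(`not_tao2011_forced_pressure_normalisation`), by an explicit smooth finite-energy solution in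
Tao's sense:

* `u ≡ 0`, `p = q`, `f = ∇q` with the **escaping shell**
  `q(t,y) = t^{-1/4} (1 - β(t y))` for `t > 0` and `q(t,y) = 0` for `t ≤ 0`, `β` the unit radial
  bump of `HarmonicProbe` (`β = 1` on `|y| ≤ 1`, `β = 0` on `|y| ≥ 2`). Since `q(t,·)` vanishes on
  the ball `|y| < 1/t`, `q` vanishes identically near `{t ≤ 0} × ℝ³` and is jointly `C^∞` on
  `ℝ × ℝ³`; `(0, q)` solves Navier–Stokes with force `∇q` for every viscosity; and
  `‖f(t)‖_{L²} ≤ c t^{-3/4}`, so `‖f‖_{L¹_t L²_x([0,1])} < ∞` (finite energy data) while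
  `sup_t ‖f(t)‖_{L²} = ∞`.
* For every `t > 0`, `g_t := q(t,·) - t^{-1/4} = -t^{-1/4} β(t ·)` is smooth with compact support
  and `∇g_t = f(t)`, so by Green's representation formula (Gilbarg–Trudinger (2.17) with Lemma 4.1,
  tree theorem `NewtonPotentialRepresentation.eq_sum_potential_of_laplacian_eq`)
  `Δ⁻¹∇·f(t) = Δ⁻¹∇·∇g_t = g_t` (`forcePotential_gradient_eq_self`), whence
  `p(t) - p̃[u(t)] - Δ⁻¹∇·f(t) = q(t) - 0 - g_t = t^{-1/4}` for EVERY `t > 0`: no bounded `C`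
  satisfies the a.e. identity on `[0,1]`.

Where the print over-claims: the proof of Lemma 25 (arXiv p. 14) says "As `u, f` are smooth and
finite energy, one sees from (p0-def) that `p₀` is bounded on compact subsets of spacetime"; for
the part `Δ⁻¹∇·f` of `p₀` this needs `sup_t ‖f(t)‖_{L²_x} < ∞` (true for Tao's `H¹` data,
`‖f‖_{L^∞_t H¹_x} < ∞`), not merely `‖f‖_{L¹_t L²_x} < ∞`; in the example `Δ⁻¹∇·f(t)(0) = -t^{-1/4}`.
The remainder of the printed proof (a.e. constancy of the harmonic part via the time-integrated
probe and Lebesgue differentiation) does not use boundedness, and the paper only ever uses `∇p`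
(Remark 26 = journal Remark 4.2), so the defect is confined to the word "bounded"; the corrected
statement (measurable `C`, a.e. representation) is vendored as
`tao2011_forced_pressure_normalisation_ae` in `TaoForcedNormalisedPressure.lean`.

## Main statements

* `forcePotential_gradient_eq_self` — `Δ⁻¹∇·(∇g) = g` for `g ∈ C²_c(ℝ³)` (kernel lemma of
  independent use: the force potential of a gradient force is the potential itself).
* `EscapingShell.isClassicalNSSolutionOn` — `(0, q)` is a classical solution with force `∇q` on
  every slab, every viscosity.
* `EscapingShell.lintegral_force_sq_le` — `∫|f(t)|² ≤ K t^{-3/2}`;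
  `EscapingShell.lintegral_forceL2_lt_top` — `∫₀¹ ‖f(t)‖_{L²} dt < ∞`.
* `EscapingShell.forcePotential_force` — `Δ⁻¹∇·f(t) = q(t) - t^{-1/4}` for `t > 0`.
* `not_tao2011_forced_pressure_normalisation` — the landed fact is false as stated.

## Mathlib / tree search

Tree (used): `forcePotential`, `forceKernel_eq_fin3`, `tao2011_forced_pressure_normalisation`
(`TaoForcedNormalisedPressure`); `NewtonPotentialRepresentation.eq_sum_potential_of_laplacian_eq`,
`NewtonPotentialHolder.newtonKernelGrad`, `….integrable_mul_kernel`, `….isSingularKernel_newtonKernelGrad`;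
`baseBump` and its lemmas, `laplacian_eq_sum_fderiv_fderiv` (`HarmonicProbe`, `WholeSpaceIBP`);
`normalisedPressure_zero`. Mathlib: `gradient`, `InnerProductSpace.toDual_symm_apply`,
`Real.contDiffAt_rpow_const_of_ne`, `Measure.addHaar_closedBall`, `integral_rpow`,
`Real.strictAntiOn_rpow_Ioi_of_exponent_neg`.

## References

* T. Tao, *Localisation and compactness properties of the Navier–Stokes global regularity
  problem*, Anal. PDE 6 (2013) 25–107 = arXiv:1108.1165 (`Tao2011`): Def. 1.1 and (6)–(9) pp. 3–5;
  Lemma 4.1 (i) = arXiv Lemma 25 (i) and its proof, p. 14 (held copy `paper:arxiv-1108.1165`,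
  chunks p0003, p0014–p0015); Remark 4.2 = arXiv Remark 26.
* D. Gilbarg, N. S. Trudinger, *Elliptic Partial Differential Equations of Second Order* (2001),
  (2.17) and Lemma 4.1 (`GilbargTrudinger2001`).
-/

noncomputable section

open MeasureTheory Set Filter Metric Topology Function Real InnerProductSpace
open scoped ENNReal NNReal RealInnerProductSpace ContDiff Laplacian

namespace Literature.Analysis.FluidPDE

open NewtonPotentialHolder NewtonPotentialRepresentation

/-! ## `Δ⁻¹∇·(∇g) = g` for compactly supported `g` -/

section Green

/-- A compact support for the zero function. [folklore] -/
private theorem hasCompactSupport_zero_fun {α β : Type*} [TopologicalSpace α] [Zero β] :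
    HasCompactSupport (0 : α → β) := by
  rw [HasCompactSupport, tsupport, Function.support_zero, closure_empty]
  exact isCompact_empty

/-- The force kernel against a gradient, in coordinates:
`⟨z, ∇g(y)⟩/(4π|z|³) = Σⱼ ∂ⱼg(y) · zⱼ/(4π|z|³) = Σⱼ ∂ⱼg(y) ∂ⱼΓ(z)`. [folklore] -/
private theorem forceKernel_gradient_eq_sum (g : EuclideanSpace ℝ (Fin 3) → ℝ)
    (y z : EuclideanSpace ℝ (Fin 3)) :
    forceKernel z (gradient g y) =
      ∑ j, fderiv ℝ g y (EuclideanSpace.single j (1 : ℝ)) * newtonKernelGrad j z := by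
  rw [forceKernel_eq_fin3, real_inner_comm, gradient, InnerProductSpace.toDual_symm_apply]
  have hz : fderiv ℝ g y z = ∑ j, z j * fderiv ℝ g y (EuclideanSpace.single j (1 : ℝ)) := by
    conv_lhs => rw [← (EuclideanSpace.basisFun (Fin 3) ℝ).sum_repr z]
    rw [map_sum]
    refine Finset.sum_congr rfl fun j _ => ?_
    rw [EuclideanSpace.basisFun_repr, EuclideanSpace.basisFun_apply, map_smul, smul_eq_mul]
  rw [hz, Finset.sum_div]
  refine Finset.sum_congr rfl fun j _ => ?_
  have hj : ⟪z, EuclideanSpace.single j (1 : ℝ)⟫ = z j := by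
    simpa using EuclideanSpace.inner_single_right j (1 : ℝ) z
  rw [newtonKernelGrad, hj]
  ring

/-- **`Δ⁻¹∇·(∇g) = g` for `g ∈ C²_c(ℝ³)`**: the force potential (Tao's `Δ⁻¹∇·`, (9)) of a
gradient force `f = ∇g` with `g` twice continuously differentiable and compactly supported is `g`
itself: `∫ ⟨x - y, ∇g(y)⟩/(4π|x - y|³) dy = Σⱼ ∫ ∂ⱼg(y) ∂ⱼΓ(x - y) dy = ∫ Γ(x - y) Δg(y) dy = g(x)`
(Green's representation formula, Gilbarg–Trudinger (2.17), with the integration by parts of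
Lemma 4.1 against `Γ ∈ W^{1,1}_loc`). [cite: GilbargTrudinger2001, (2.17) with Lemma 4.1] -/
theorem forcePotential_gradient_eq_self {g : EuclideanSpace ℝ (Fin 3) → ℝ} (hg : ContDiff ℝ 2 g)
    (hgc : HasCompactSupport g) (x : EuclideanSpace ℝ (Fin 3)) :
    forcePotential (gradient g) x = g x := by
  -- the partial derivatives `Gⱼ = ∂ⱼg ∈ C¹_c`
  set G : Fin 3 → EuclideanSpace ℝ (Fin 3) → ℝ :=
    fun j y => fderiv ℝ g y (EuclideanSpace.single j (1 : ℝ)) with hGdef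
  have hG : ∀ j, ContDiff ℝ 1 (G j) := fun j =>
    (hg.fderiv_right (m := 1) le_rfl).clm_apply contDiff_const
  have hGc : ∀ j, HasCompactSupport (G j) := fun j =>
    hgc.fderiv_apply (𝕜 := ℝ) (EuclideanSpace.single j (1 : ℝ))
  -- `Δg = Σⱼ ∂ⱼGⱼ`
  have hΔ : ∀ y, (Δ g) y =
      ∑ j, fderiv ℝ (G j) y (EuclideanSpace.single j (1 : ℝ)) +
        (fun _ : EuclideanSpace ℝ (Fin 3) => (0 : ℝ)) y := by
    intro y
    rw [add_zero, laplacian_eq_sum_fderiv_fderiv (EuclideanSpace.basisFun (Fin 3) ℝ) hg y]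
    simp only [EuclideanSpace.basisFun_apply, hGdef]
  -- Green's representation
  have h0c : HasCompactSupport (fun _ : EuclideanSpace ℝ (Fin 3) => (0 : ℝ)) :=
    hasCompactSupport_zero_fun
  have hrep := eq_sum_potential_of_laplacian_eq hg hgc hG hGc
    (H := fun _ : EuclideanSpace ℝ (Fin 3) => (0 : ℝ)) continuous_const h0c hΔ x
  simp only [zero_mul, integral_zero, add_zero] at hrep
  -- integrability of each `y ↦ Gⱼ(y) ∂ⱼΓ(x - y)`
  have hint : ∀ j, Integrable (fun y => G j y * newtonKernelGrad j (x - y))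
      (volume : Measure (EuclideanSpace ℝ (Fin 3))) := by
    intro j
    have hpq : (4 : ℝ).HolderConjugate (4 / 3) := by
      rw [Real.holderConjugate_iff]; norm_num
    obtain ⟨r, hr⟩ := (hGc j).isCompact.isBounded.subset_ball (0 : EuclideanSpace ℝ (Fin 3))
    have hsupp : support (G j) ⊆ ball (0 : EuclideanSpace ℝ (Fin 3)) r :=
      (subset_tsupport _).trans hr
    exact integrable_mul_kernel (isSingularKernel_newtonKernelGrad j) (by positivity) hpq
      (by norm_num) ((hG j).continuous.memLp_of_hasCompactSupport (hGc j)) hsupp x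
  rw [forcePotential]
  simp_rw [forceKernel_gradient_eq_sum g]
  rw [integral_finsetSum _ fun j _ => hint j, hrep]

/-- The force potential of the gradient of a compactly supported `C²` function, as functions:
`Δ⁻¹∇·(∇g) = g`. [cite: GilbargTrudinger2001, (2.17) with Lemma 4.1] -/
theorem forcePotential_gradient_eq {g : EuclideanSpace ℝ (Fin 3) → ℝ} (hg : ContDiff ℝ 2 g)
    (hgc : HasCompactSupport g) : forcePotential (gradient g) = g :=
  funext (forcePotential_gradient_eq_self hg hgc)

end Green

/-! ## The escaping shell -/

namespace EscapingShell

/-- The amplitude `a(t) = t^{-1/4}` (unbounded as `t → 0⁺`, with `a(t) t^{-1/2}` integrable).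
[cite: Tao2011, Lemma 4.1 (i) (arXiv Lemma 25 (i)), p. 14] -/
def amplitude (t : ℝ) : ℝ := t ^ (-(1 / 4 : ℝ))

/-- The escaping-shell pressure `q(t,y) = t^{-1/4}(1 - β(t y))` for `t > 0`, `0` for `t ≤ 0`
(`β = baseBump`): zero on `|y| ≤ 1/t`, equal to `t^{-1/4}` on `|y| ≥ 2/t`.
[cite: Tao2011, Lemma 4.1 (i) (arXiv Lemma 25 (i)), p. 14] -/
def pressure (t : ℝ) (y : EuclideanSpace ℝ (Fin 3)) : ℝ :=
  if 0 < t then amplitude t * (1 - baseBump (t • y)) else 0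

/-- The escaping-shell force `f(t) = ∇q(t)` (a gradient, supported in the shell `1/t ≤ |y| ≤ 2/t`).
[cite: Tao2011, Lemma 4.1 (i) (arXiv Lemma 25 (i)), p. 14] -/
def force (t : ℝ) (y : EuclideanSpace ℝ (Fin 3)) : EuclideanSpace ℝ (Fin 3) :=
  gradient (pressure t) y

/-- The compactly supported part `g_t(y) = -t^{-1/4} β(t y)` of `q(t,·)` (`q(t) = g_t + t^{-1/4}`).
[cite: Tao2011, Lemma 4.1 (i) (arXiv Lemma 25 (i)), p. 14] -/
def shell (t : ℝ) (y : EuclideanSpace ℝ (Fin 3)) : ℝ := -amplitude t * baseBump (t • y)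

variable {t : ℝ}

/-- `a(t) > 0` for `t > 0`. [folklore] -/
private theorem amplitude_pos (ht : 0 < t) : 0 < amplitude t := Real.rpow_pos_of_pos ht _

/-- The formula for `q(t,·)`, `t > 0`. [folklore] -/
private theorem pressure_of_pos (ht : 0 < t) :
    pressure t = fun y => amplitude t * (1 - baseBump (t • y)) := by
  funext y; simp [pressure, ht]

/-- `q(t,·) = 0` for `t ≤ 0`. [folklore] -/
private theorem pressure_of_nonpos (ht : t ≤ 0) : pressure t = 0 := by
  funext y; simp [pressure, not_lt.2 ht]

/-- `q(t) = g_t + a(t)` for `t > 0`. [folklore] -/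
private theorem pressure_eq_shell_add (ht : 0 < t) :
    pressure t = fun y => shell t y + amplitude t := by
  rw [pressure_of_pos ht]; funext y; simp only [shell]; ring

/-- `q` vanishes on the space-time region `t (1 + |y|) < 1` (which contains `{t ≤ 0}`). [folklore] -/
private theorem pressure_eq_zero_of_lt {y : EuclideanSpace ℝ (Fin 3)} (h : t * (1 + ‖y‖) < 1) :
    pressure t y = 0 := by
  by_cases ht : 0 < t
  · have hy : ‖t • y‖ ≤ 1 := by
      rw [norm_smul, Real.norm_eq_abs, abs_of_pos ht]
      nlinarith [norm_nonneg y]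
    simp [pressure, ht, baseBump_eq_one hy]
  · simp [pressure, ht]

/-! ### Smoothness -/

/-- The formula valid for `t > 0`, as a function on space-time (plumbing). [folklore] -/
private def pressurePos (z : ℝ × EuclideanSpace ℝ (Fin 3)) : ℝ :=
  amplitude z.1 * (1 - baseBump (z.1 • z.2))

/-- The positive-time formula is smooth at every point with `t > 0`. [folklore] -/
private theorem contDiffAt_pressurePos {z : ℝ × EuclideanSpace ℝ (Fin 3)} (hz : 0 < z.1) :
    ContDiffAt ℝ ∞ pressurePos z := by
  have h1 : ContDiffAt ℝ ∞ (fun w : ℝ × EuclideanSpace ℝ (Fin 3) => amplitude w.1) z :=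
    (Real.contDiffAt_rpow_const_of_ne (p := -(1 / 4 : ℝ)) hz.ne').comp z contDiffAt_fst
  have h2 : ContDiff ℝ ∞ (fun w : ℝ × EuclideanSpace ℝ (Fin 3) => 1 - baseBump (w.1 • w.2)) :=
    contDiff_const.sub ((contDiff_baseBump (n := ⊤)).comp (contDiff_fst.smul contDiff_snd))
  exact h1.mul h2.contDiffAt

/-- **`q` is jointly smooth on `ℝ × ℝ³`** (on `{t > 0}` it is the smooth formula; near `{t ≤ 0}`
it vanishes identically, the shell having escaped to spatial infinity).
[cite: Tao2011, Lemma 4.1 (i) (arXiv Lemma 25 (i)), p. 14] -/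
theorem contDiff_pressure : ContDiff ℝ ∞ (uncurry pressure) := by
  refine contDiff_iff_contDiffAt.2 fun z => ?_
  by_cases hz : 0 < z.1
  · -- agree with the smooth formula near `z`
    have hev : uncurry pressure =ᶠ[𝓝 z] pressurePos := by
      filter_upwards [(isOpen_lt continuous_const continuous_fst).mem_nhds hz] with w hw
      simp [uncurry, pressure, pressurePos, hw]
    exact (contDiffAt_pressurePos hz).congr_of_eventuallyEq hev
  · -- vanish identically near `z`
    have hV : IsOpen {w : ℝ × EuclideanSpace ℝ (Fin 3) | w.1 * (1 + ‖w.2‖) < 1} :=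
      isOpen_lt (continuous_fst.mul (continuous_const.add (continuous_norm.comp continuous_snd)))
        continuous_const
    have hzV : z ∈ {w : ℝ × EuclideanSpace ℝ (Fin 3) | w.1 * (1 + ‖w.2‖) < 1} := by
      have : z.1 * (1 + ‖z.2‖) ≤ 0 :=
        mul_nonpos_of_nonpos_of_nonneg (not_lt.1 hz) (by positivity)
      show z.1 * (1 + ‖z.2‖) < 1
      linarith
    have hev : uncurry pressure =ᶠ[𝓝 z] fun _ => 0 := by
      filter_upwards [hV.mem_nhds hzV] with w hw
      exact pressure_eq_zero_of_lt hw
    exact contDiffAt_const.congr_of_eventuallyEq hev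

/-- **`f = ∇q` is jointly smooth on `ℝ × ℝ³`.** [cite: Tao2011, Lemma 4.1 (i) (arXiv Lemma 25 (i)), p. 14] -/
theorem contDiff_force : ContDiff ℝ ∞ (uncurry force) := by
  have h1 : ContDiff ℝ ∞ fun z : ℝ × EuclideanSpace ℝ (Fin 3) => fderiv ℝ (pressure z.1) z.2 := by
    refine ContDiff.fderiv (f := fun z : ℝ × EuclideanSpace ℝ (Fin 3) => pressure z.1)
      (g := fun z => z.2) (m := ∞) ?_ contDiff_snd le_rfl
    exact contDiff_pressure.comp (contDiff_fst.fst.prodMk contDiff_snd)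
  have e : uncurry force = fun z : ℝ × EuclideanSpace ℝ (Fin 3) =>
      (InnerProductSpace.toDual ℝ (EuclideanSpace ℝ (Fin 3))).symm (fderiv ℝ (pressure z.1) z.2) := by
    funext z; rfl
  rw [e]
  exact (InnerProductSpace.toDual ℝ (EuclideanSpace ℝ (Fin 3))).symm.contDiff.comp h1

/-- `q` is smooth on every slab. [folklore] -/
private theorem isSmoothSpaceTimeOn_pressure (S : Set ℝ) : IsSmoothSpaceTimeOn S pressure :=
  contDiff_pressure.contDiffOn

/-- **The force is smooth on every slab** (Tao's smooth data, Def. 1.1), in the tree's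
`IsSmoothSpaceTimeOn` form. [cite: Tao2011, Def. 1.1 p. 3 and Lemma 4.1 (i), p. 14] -/
theorem isSmoothSpaceTimeOn_force (S : Set ℝ) : IsSmoothSpaceTimeOn S force :=
  contDiff_force.contDiffOn

/-! ### `(0, q)` solves Navier–Stokes with force `∇q` -/

/-- The Laplacian of the zero field vanishes. [folklore] -/
private theorem laplacian_zero_field (x : EuclideanSpace ℝ (Fin 3)) :
    Δ (0 : EuclideanSpace ℝ (Fin 3) → EuclideanSpace ℝ (Fin 3)) x = 0 := by
  rw [laplacian_eq_iteratedFDeriv_orthonormalBasis _ (EuclideanSpace.basisFun (Fin 3) ℝ)]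
  simp

/-- **The escaping shell is a classical solution**: `u ≡ 0`, `p = q`, `f = ∇q` satisfy the
Navier–Stokes system on every time set `[0,T]`, for every viscosity `ν` (momentum: `∇p = f`).
[cite: Tao2011, Lemma 4.1 (i) (arXiv Lemma 25 (i)), p. 14] -/
theorem isClassicalNSSolutionOn (ν T : ℝ) :
    IsClassicalNSSolutionOn (Icc 0 T) ν force 0 pressure where
  smooth_velocity := by
    have e : uncurry (0 : ℝ → EuclideanSpace ℝ (Fin 3) → EuclideanSpace ℝ (Fin 3)) =
        fun _ => 0 := by
      funext z; rfl
    show ContDiffOn ℝ ∞ (uncurry (0 : ℝ → EuclideanSpace ℝ (Fin 3) → EuclideanSpace ℝ (Fin 3))) _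
    rw [e]; exact contDiffOn_const
  smooth_pressure := isSmoothSpaceTimeOn_pressure _
  momentum := by
    intro t _ x
    have h1 : timeDerivWithin (Icc 0 T)
        (0 : ℝ → EuclideanSpace ℝ (Fin 3) → EuclideanSpace ℝ (Fin 3)) t x = 0 := by
      simp only [timeDerivWithin_apply, Pi.zero_apply, derivWithin_fun_const]
    rw [h1, convect_apply, Pi.zero_apply, Pi.zero_apply, fderiv_zero, laplacian_zero_field]
    simp [force]
  divFree := by
    intro t _ x
    simp [VectorCalculus.divergence, fderiv_zero]

/-! ### The size of the force -/

/-- For `t > 0` the force is `f(t,y) = -(a(t) t) ∇β(t y)` (as a dual vector). [folklore] -/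
private theorem fderiv_pressure_of_pos (ht : 0 < t) (y : EuclideanSpace ℝ (Fin 3)) :
    fderiv ℝ (pressure t) y = -(amplitude t * t) • fderiv ℝ baseBump (t • y) := by
  rw [pressure_of_pos ht]
  have hβ : DifferentiableAt ℝ baseBump (t • y) :=
    (contDiff_baseBump (n := 1)).differentiable (by simp) _
  have hcomp : HasFDerivAt (fun y : EuclideanSpace ℝ (Fin 3) => baseBump (t • y))
      ((fderiv ℝ baseBump (t • y)).comp (t • ContinuousLinearMap.id ℝ _)) y := by
    have hl : HasFDerivAt (fun y : EuclideanSpace ℝ (Fin 3) => t • y)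
        (t • ContinuousLinearMap.id ℝ _) y := (hasFDerivAt_id y).const_smul t
    exact hβ.hasFDerivAt.comp y hl
  have h : HasFDerivAt (fun y : EuclideanSpace ℝ (Fin 3) => amplitude t * (1 - baseBump (t • y)))
      (amplitude t • (0 - (fderiv ℝ baseBump (t • y)).comp (t • ContinuousLinearMap.id ℝ _))) y :=
    ((hasFDerivAt_const (1 : ℝ) y).sub hcomp).const_mul (amplitude t)
  rw [h.fderiv]
  ext v
  simp [mul_comm, mul_assoc, mul_left_comm]

/-- The derivative of `β` vanishes off the closed ball of radius `2`. [folklore] -/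
private theorem fderiv_baseBump_eq_zero {w : EuclideanSpace ℝ (Fin 3)} (hw : 2 < ‖w‖) :
    fderiv ℝ baseBump w = 0 := by
  have hev : (baseBump : EuclideanSpace ℝ (Fin 3) → ℝ) =ᶠ[𝓝 w] fun _ => 0 := by
    filter_upwards [(isOpen_lt continuous_const continuous_norm).mem_nhds hw] with v hv
    exact baseBump_eq_zero hv.le
  rw [hev.fderiv_eq, fderiv_const_apply]

/-- **Pointwise bound**: `|f(t,y)| ≤ a(t) t ‖∇β‖_∞` and `f(t,y) = 0` for `|y| > 2/t`. [folklore] -/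
private theorem norm_force_le (ht : 0 < t) {Cβ : ℝ}
    (hCβ : ∀ w : EuclideanSpace ℝ (Fin 3), ‖fderiv ℝ baseBump w‖ ≤ Cβ) (y : EuclideanSpace ℝ (Fin 3)) :
    ‖force t y‖ ≤ (closedBall (0 : EuclideanSpace ℝ (Fin 3)) (2 / t)).indicator
      (fun _ => amplitude t * t * Cβ) y := by
  have hn : ‖force t y‖ = amplitude t * t * ‖fderiv ℝ baseBump (t • y)‖ := by
    rw [force, gradient, LinearIsometryEquiv.norm_map, fderiv_pressure_of_pos ht, norm_smul,
      norm_neg, Real.norm_eq_abs, abs_of_pos (mul_pos (amplitude_pos ht) ht)]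
  by_cases hy : y ∈ closedBall (0 : EuclideanSpace ℝ (Fin 3)) (2 / t)
  · rw [indicator_of_mem hy, hn]
    exact mul_le_mul_of_nonneg_left (hCβ _) (mul_pos (amplitude_pos ht) ht).le
  · rw [indicator_of_notMem hy, hn]
    have hy' : 2 < ‖t • y‖ := by
      rw [mem_closedBall_zero_iff, not_le, div_lt_iff₀ ht] at hy
      rw [norm_smul, Real.norm_eq_abs, abs_of_pos ht]; linarith
    rw [fderiv_baseBump_eq_zero hy', norm_zero, mul_zero]

/-- **`L²` size of the force**: `∫ |f(t)|² ≤ (8 |B₁| ‖∇β‖²_∞) · a(t)² / t = K t^{-3/2}` for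
`t > 0`. [cite: Tao2011, Lemma 4.1 (i) (arXiv Lemma 25 (i)), p. 14] -/
theorem lintegral_force_sq_le (ht : 0 < t) {Cβ : ℝ}
    (hCβ : ∀ w : EuclideanSpace ℝ (Fin 3), ‖fderiv ℝ baseBump w‖ ≤ Cβ) :
    ∫⁻ y, ‖force t y‖ₑ ^ 2 ≤
      ENNReal.ofReal ((amplitude t * t * Cβ) ^ 2 * (2 / t) ^ 3) *
        volume (ball (0 : EuclideanSpace ℝ (Fin 3)) 1) := by
  have hC0 : 0 ≤ Cβ := (norm_nonneg _).trans (hCβ 0)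
  set M : ℝ := amplitude t * t * Cβ with hM
  have hM0 : 0 ≤ M := by rw [hM]; exact mul_nonneg (mul_pos (amplitude_pos ht) ht).le hC0
  have hpt : ∀ y, ‖force t y‖ₑ ^ 2 ≤
      (closedBall (0 : EuclideanSpace ℝ (Fin 3)) (2 / t)).indicator (fun _ => ENNReal.ofReal (M ^ 2)) y := by
    intro y
    have h := norm_force_le ht hCβ y
    by_cases hy : y ∈ closedBall (0 : EuclideanSpace ℝ (Fin 3)) (2 / t)
    · rw [indicator_of_mem hy] at h ⊢
      rw [← enorm_norm, Real.enorm_eq_ofReal (norm_nonneg _), ← ENNReal.ofReal_pow (norm_nonneg _)]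
      exact ENNReal.ofReal_le_ofReal (pow_le_pow_left₀ (norm_nonneg _) h 2)
    · rw [indicator_of_notMem hy] at h ⊢
      have : force t y = 0 := norm_le_zero_iff.1 h
      simp [this]
  calc ∫⁻ y, ‖force t y‖ₑ ^ 2
      ≤ ∫⁻ y, (closedBall (0 : EuclideanSpace ℝ (Fin 3)) (2 / t)).indicator
          (fun _ => ENNReal.ofReal (M ^ 2)) y := lintegral_mono hpt
    _ = ENNReal.ofReal (M ^ 2) * volume (closedBall (0 : EuclideanSpace ℝ (Fin 3)) (2 / t)) := by
        rw [lintegral_indicator measurableSet_closedBall, setLIntegral_const]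
    _ = ENNReal.ofReal (M ^ 2 * (2 / t) ^ 3) * volume (ball (0 : EuclideanSpace ℝ (Fin 3)) 1) := by
        rw [Measure.addHaar_closedBall _ _ (by positivity : (0 : ℝ) ≤ 2 / t),
          finrank_euclideanSpace_fin, ← mul_assoc, ← ENNReal.ofReal_mul (sq_nonneg _)]

/-- The constant `K = 8 |B₁| C_β²` and the exponent: `(a(t) t C)² (2/t)³ = 8 C² a(t)²/t = 8 C² t^{-3/2}`. [folklore] -/
private theorem size_identity (ht : 0 < t) (C : ℝ) :
    (amplitude t * t * C) ^ 2 * (2 / t) ^ 3 = 8 * C ^ 2 * t ^ (-(3 / 2 : ℝ)) := by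
  have ha : amplitude t ^ 2 = t ^ (-(1 / 2 : ℝ)) := by
    rw [amplitude, ← Real.rpow_natCast, ← Real.rpow_mul ht.le]; norm_num
  have h32 : t ^ (-(3 / 2 : ℝ)) = t ^ (-(1 / 2 : ℝ)) * t⁻¹ := by
    rw [← Real.rpow_neg_one, ← Real.rpow_add ht]; norm_num
  have ht0 : t ≠ 0 := ht.ne'
  rw [h32, ← ha]
  field_simp
  ring

/-- **`‖f(t)‖_{L²} ≤ K' t^{-3/4}`** for `t > 0`, with `K' = (8 C_β² |B₁|)^{1/2}`.
[cite: Tao2011, Lemma 4.1 (i) (arXiv Lemma 25 (i)), p. 14] -/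
theorem lintegral_force_sq_rpow_half_le (ht : 0 < t) {Cβ : ℝ}
    (hCβ : ∀ w : EuclideanSpace ℝ (Fin 3), ‖fderiv ℝ baseBump w‖ ≤ Cβ) :
    (∫⁻ y, ‖force t y‖ₑ ^ 2) ^ (1 / 2 : ℝ) ≤
      ENNReal.ofReal ((8 * Cβ ^ 2 * (volume (ball (0 : EuclideanSpace ℝ (Fin 3)) 1)).toReal) ^
        (1 / 2 : ℝ) * t ^ (-(3 / 4 : ℝ))) := by
  have hV : volume (ball (0 : EuclideanSpace ℝ (Fin 3)) 1) ≠ ⊤ := measure_ball_lt_top.ne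
  have h1 := lintegral_force_sq_le ht hCβ
  rw [size_identity ht, ← ENNReal.ofReal_toReal hV, ← ENNReal.ofReal_mul (by positivity)] at h1
  have h2 := ENNReal.rpow_le_rpow h1 (by norm_num : (0 : ℝ) ≤ 1 / 2)
  refine h2.trans (le_of_eq ?_)
  rw [ENNReal.ofReal_rpow_of_nonneg (by positivity) (by norm_num)]
  congr 1
  rw [show 8 * Cβ ^ 2 * t ^ (-(3 / 2 : ℝ)) * (volume (ball (0 : EuclideanSpace ℝ (Fin 3)) 1)).toReal
      = (8 * Cβ ^ 2 * (volume (ball (0 : EuclideanSpace ℝ (Fin 3)) 1)).toReal) * t ^ (-(3 / 2 : ℝ)) by ring,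
    Real.mul_rpow (by positivity) (Real.rpow_nonneg ht.le _), ← Real.rpow_mul ht.le]
  norm_num

/-- **Finite energy data**: `∫₀ᵀ ‖f(t)‖_{L²_x} dt < ∞` on every slab `[0,T]`
(`‖f(t)‖_{L²} ≤ K' t^{-3/4}`, an integrable singularity).
[cite: Tao2011, (6) p. 3 and Lemma 4.1 (i), p. 14] -/
theorem lintegral_forceL2_lt_top (T : ℝ) :
    ∫⁻ t in Icc 0 T, (∫⁻ y, ‖force t y‖ₑ ^ 2) ^ (1 / 2 : ℝ) < ⊤ := by
  obtain ⟨⟨Cβ, hCβ⟩, -⟩ := exists_bound_baseBump_derivs (E := EuclideanSpace ℝ (Fin 3))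
  set K' : ℝ := (8 * Cβ ^ 2 * (volume (ball (0 : EuclideanSpace ℝ (Fin 3)) 1)).toReal) ^
    (1 / 2 : ℝ) with hK'
  -- pointwise bound on `[0,T]` (at `t = 0` the force vanishes)
  have hpt : ∀ t ∈ Icc (0 : ℝ) T, (∫⁻ y, ‖force t y‖ₑ ^ 2) ^ (1 / 2 : ℝ) ≤
      ENNReal.ofReal (K' * t ^ (-(3 / 4 : ℝ))) := by
    intro t ht
    rcases ht.1.eq_or_lt with h0 | hpos
    · subst h0
      have hp0 : pressure 0 = fun _ => (0 : ℝ) := pressure_of_nonpos le_rfl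
      have : force 0 = fun _ => 0 := by
        funext y
        rw [force, hp0]
        simp [gradient]
      simp [this]
    · exact lintegral_force_sq_rpow_half_le hpos hCβ
  -- the majorant is integrable on `[0,T]`
  have hint : IntegrableOn (fun t : ℝ => K' * t ^ (-(3 / 4 : ℝ))) (Icc 0 T) volume := by
    have h := (intervalIntegral.intervalIntegrable_rpow' (a := 0) (b := T)
      (by norm_num : (-1 : ℝ) < -(3 / 4 : ℝ))).const_mul K'
    rcases le_or_gt 0 T with hT | hT
    · rw [integrableOn_Icc_iff_integrableOn_Ioc]
      exact (intervalIntegrable_iff_integrableOn_Ioc_of_le hT).1 h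
    · rw [Icc_eq_empty (not_le.2 hT)]
      exact integrableOn_empty
  calc ∫⁻ t in Icc 0 T, (∫⁻ y, ‖force t y‖ₑ ^ 2) ^ (1 / 2 : ℝ)
      ≤ ∫⁻ t in Icc 0 T, ENNReal.ofReal (K' * t ^ (-(3 / 4 : ℝ))) :=
        setLIntegral_mono' measurableSet_Icc fun t ht => hpt t ht
    _ ≤ ∫⁻ t in Icc 0 T, ‖K' * t ^ (-(3 / 4 : ℝ))‖ₑ := lintegral_ofReal_le_lintegral_enorm _
    _ < ⊤ := hint.2

/-! ### The force potential of the shell -/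

/-- `g_t` is smooth. [folklore] -/
private theorem contDiff_shell (t : ℝ) : ContDiff ℝ ∞ (shell t) :=
  contDiff_const.mul ((contDiff_baseBump (n := ⊤)).comp (contDiff_const_smul t))

/-- `g_t` has compact support (`t > 0`). [folklore] -/
private theorem hasCompactSupport_shell (ht : 0 < t) : HasCompactSupport (shell t) :=
  ((hasCompactSupport_baseBump (E := EuclideanSpace ℝ (Fin 3))).comp_smul ht.ne').mul_left

/-- `f(t) = ∇g_t` (`q(t)` and `g_t` differ by a constant). [folklore] -/
private theorem force_eq_gradient_shell (ht : 0 < t) : force t = gradient (shell t) := by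
  funext y
  rw [force, pressure_eq_shell_add ht, gradient, gradient, fderiv_add_const]

/-- **The force potential of the escaping shell**: `Δ⁻¹∇·f(t) = q(t) - t^{-1/4}` for every
`t > 0` (`f(t) = ∇g_t`, `g_t = q(t) - t^{-1/4} ∈ C^∞_c`, and `Δ⁻¹∇·∇g_t = g_t`).
[cite: Tao2011, (9) p. 5 and Lemma 4.1 (i), p. 14] -/
theorem forcePotential_force (ht : 0 < t) (x : EuclideanSpace ℝ (Fin 3)) :
    forcePotential (force t) x = pressure t x - amplitude t := by
  rw [force_eq_gradient_shell ht,
    forcePotential_gradient_eq_self ((contDiff_shell t).of_le (by norm_cast))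
      (hasCompactSupport_shell ht) x,
    pressure_eq_shell_add ht]
  ring

/-- The amplitude exceeds any bound near `t = 0⁺`: for `0 < t < (M⁴)⁻¹`, `M ≥ 1`, `t^{-1/4} > M`.
[folklore] -/
private theorem lt_amplitude {M : ℝ} (hM : 1 ≤ M) (ht : 0 < t) (htM : t < (M ^ 4)⁻¹) :
    M < amplitude t := by
  have hM0 : 0 < M := by linarith
  have hanti := Real.strictAntiOn_rpow_Ioi_of_exponent_neg (r := -(1 / 4 : ℝ)) (by norm_num)
  have h : ((M ^ 4)⁻¹ : ℝ) ^ (-(1 / 4 : ℝ)) < t ^ (-(1 / 4 : ℝ)) :=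
    hanti (mem_Ioi.2 ht) (mem_Ioi.2 (by positivity : (0 : ℝ) < (M ^ 4)⁻¹)) htM
  -- `((M⁴)⁻¹)^{-1/4} = M`
  have e : ((M ^ 4)⁻¹ : ℝ) ^ (-(1 / 4 : ℝ)) = M := by
    rw [Real.inv_rpow (by positivity), ← Real.rpow_natCast, ← Real.rpow_mul hM0.le,
      ← Real.rpow_neg hM0.le]
    norm_num
  calc M = ((M ^ 4)⁻¹ : ℝ) ^ (-(1 / 4 : ℝ)) := e.symm
    _ < t ^ (-(1 / 4 : ℝ)) := h
    _ = amplitude t := rfl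

end EscapingShell

/-! ## The refutation -/

/-- **Tao 2011, Lemma 4.1 (i) WITH force, as landed with the printed conjunct "`C` bounded", is
false.** The escaping shell `(u, p, f) = (0, q, ∇q)` on `[0,1]` (viscosity `1`) meets every
hypothesis of `tao2011_forced_pressure_normalisation` — classical on the closed slab, `f` smooth
with `∫₀¹‖f(t)‖_{L²} dt < ∞`, `u` of finite (zero) energy — while
`p(t) - p̃[u(t)] - Δ⁻¹∇·f(t) = t^{-1/4}` for every `t ∈ (0,1]`; a bounded `C` with the a.e.
identity would give `t^{-1/4} ≤ M` for a.e. `t ∈ [0,1]`, absurd on `(0, (M⁴)⁻¹)`. The corrected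
statement (measurable `C`, no boundedness) is `tao2011_forced_pressure_normalisation_ae`.
[cite: Tao2011, Lemma 4.1 (i) (arXiv Lemma 25 (i)), p. 14] -/
theorem not_tao2011_forced_pressure_normalisation : ¬ tao2011_forced_pressure_normalisation := by
  intro h
  have hE : ∃ C : ℝ≥0, ∀ t ∈ Icc (0 : ℝ) 1,
      ∫⁻ x, ‖(0 : ℝ → EuclideanSpace ℝ (Fin 3) → EuclideanSpace ℝ (Fin 3)) t x‖ₑ ^ 2 ≤ C :=
    ⟨0, fun t _ => by simp⟩
  obtain ⟨C, -, ⟨M, hM⟩, hae⟩ := h one_pos one_pos (EscapingShell.isClassicalNSSolutionOn 1 1)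
    (EscapingShell.isSmoothSpaceTimeOn_force _) (EscapingShell.lintegral_forceL2_lt_top 1) hE
  -- for a.e. `t ∈ [0,1]` with `t > 0`: `C t = t^{-1/4} ≤ max M 1`
  set M' : ℝ := max M 1 with hM'
  have hM'1 : 1 ≤ M' := le_max_right _ _
  have hbd : ∀ᵐ t ∂(volume.restrict (Icc (0 : ℝ) 1)), 0 < t → EscapingShell.amplitude t ≤ M' := by
    filter_upwards [hae, ae_restrict_mem measurableSet_Icc] with t ht htI hpos
    have h0 := ht 0
    rw [Pi.zero_apply, normalisedPressure_zero, Pi.zero_apply, zero_add,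
      EscapingShell.forcePotential_force hpos] at h0
    have hC : C t = EscapingShell.amplitude t := by linarith
    calc EscapingShell.amplitude t = C t := hC.symm
      _ ≤ |C t| := le_abs_self _
      _ ≤ M := hM t htI
      _ ≤ M' := le_max_left _ _
  -- but the amplitude exceeds `M'` on `(0, δ)`, a set of positive measure in `[0,1]`
  set δ : ℝ := min 1 (M' ^ 4)⁻¹ with hδ
  have hδ0 : 0 < δ := lt_min one_pos (by positivity)
  have hsub : Ioo (0 : ℝ) δ ⊆ {t | ¬ (0 < t → EscapingShell.amplitude t ≤ M')} := by
    intro t ht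
    rw [mem_setOf_eq]
    intro himp
    have hlt := EscapingShell.lt_amplitude hM'1 ht.1 (ht.2.trans_le (min_le_right _ _))
    exact absurd (himp ht.1) (not_le.mpr hlt)
  have hnull : volume.restrict (Icc (0 : ℝ) 1) (Ioo (0 : ℝ) δ) = 0 :=
    measure_mono_null hsub (ae_iff.1 hbd)
  rw [Measure.restrict_apply measurableSet_Ioo,
    inter_eq_self_of_subset_left (Ioo_subset_Icc_self.trans (Icc_subset_Icc_right (min_le_left _ _))),
    Real.volume_Ioo, sub_zero, ENNReal.ofReal_eq_zero] at hnull
  exact absurd hnull (not_le.2 hδ0)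

end Literature.Analysis.FluidPDE

end
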